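import Literature.Probability.LatticeModels.LeeYangZeroCounting
import Literature.Probability.LatticeModels.CriticalTwoPointLower

/-!
# `stub_isothermForcesGap` (S5) for line `SketchPub` of crux `CoulombImpliesNontrivial`

Crux `CoulombImpliesNontrivial` of route `PerfectScreening` (Ising3DConformalLimit), registered stub
S5 ("isotherm forces gap"): the Lee–Yang package of every critical block
(`⟨cos(θ M_L)⟩ = cos^m θ ∏ᵢ (1 - bᵢ sin² θ)`, `⟨e^{tM_L}⟩ = cosh^m t ∏ᵢ (1 + bᵢ sinh² t)`, the
tilted mean, `Σ_L = m + 2∑bᵢ`, `m + 2n ≤ (2L+1)³`), block-field domination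
`⟨M_L e^{β_c h M_L}⟩ ≤ (2L+1)³ m(β_c,h) ⟨e^{β_c h M_L}⟩`, the two-sided block variance
`c L⁵ ≤ Σ_L ≤ C L⁵` and the critical-isotherm bound `m(β_c,h) ≤ A h^{1/5}` force, for all large `L`,
a zero `θ₁` of `θ ↦ ⟨cos(θ M_L)⟩` with `θ₁² Σ_L ≤ C'`.

This is pure real analysis and is proved for ABSTRACT functions `V, mag, Ecos, Eexp, Etilt`
constrained only by the four hypotheses (`isothermForcesGap_of_hypotheses`); the registered
statement is the instance `V L = ⟨M_L²⟩`, `mag = m(β_c(3), ·)`, … . The argument ("zero counting by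
the critical isotherm"), with `β = β_c > 0`, `N = (2L+1)³ ≤ 27L³`, `u₀ = min h₀ 1`, `A₁ = max A 1`:
1. tilting by `t = βu⁵`, `0 < u ≤ u₀`, and cancelling `⟨e^{tM_L}⟩ > 0` in the domination bound gives
   `m tanh t + ∑ᵢ 2bᵢ sinh t cosh t/(1 + bᵢ sinh² t) ≤ N m(β, u⁵) ≤ N A₁ u`, whence the count
   `#{i : bᵢ sinh² t ≥ 1} ≤ β A₁ N u⁶` (`LeeYangZeroCounting.card_filter_le_mul_of_tilted_sum_le`);
2. the dyadic layer cake along the levels `Λ_j = 1/sinh²(β(u₀/2^j)⁵)`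
   (`LeeYangZeroCounting.sum_le_of_card_filter_le`) gives `∑bᵢ ≤ nΛ₀ + Q N 16^J` for the least
   `J` with `max bᵢ ≤ Λ_J`; with `cL⁵ ≤ m + 2∑bᵢ` and `m + 2n ≤ N ≤ 27L³` this forces
   `16^J ≳ L²`, and minimality of `J` (`LeeYangZeroCounting.pow_lt_of_inv_sinh_sq_lt`) turns
   `1024^J ≳ L⁵` into `max bᵢ ≥ c₂ L⁵` (`exists_coeff_ge`);
3. `θ₁ = arcsin((max bᵢ)^{-1/2})` kills the factor `1 - bᵢ sin² θ₁` and Jordan's inequality gives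
   `θ₁² ≤ (π²/4)/max bᵢ`, so `θ₁² Σ_L ≤ (π²/4) C L⁵/(c₂ L⁵)`.
-/

noncomputable section

namespace Summit.CriticalPhenomena.Ising3DConformalLimit.PerfectScreeningCoulombImpliesNontrivial

open Literature.Probability.LatticeModels Filter Set Finset
open scoped Topology BigOperators
open LeeYangZeroCounting

/-- **Step 2 of S5: the largest Lee–Yang coefficient is `≳ L⁵`.** For reals `bᵢ` (`i < n`),
`m ≥ 0`, `0 < N ≤ 27L³`, `L ≥ 1`, `m + 2n ≤ N`, `cL⁵ ≤ m + 2∑bᵢ` and the counting bound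
`#{i : bᵢ sinh²(βu⁵) ≥ 1} ≤ βA₁N u⁶` (`0 < u ≤ u₀`): if `54(1 + Λ₀) + 54Q < cL` (with
`Λ₀ = 1/sinh²(βu₀⁵)`, `Q = 1024βA₁/(15β²u₀⁴)`, `ρ² = c/(108Q)`, `D = β²u₀¹⁰cosh²(βu₀⁵)`), then some
`bᵢ ≥ (ρ⁵/(1024 D)) L⁵`. -/
theorem exists_coeff_ge {n : ℕ} (b : Fin n → ℝ)
    {β u₀ A₁ c m N L Λ₀ Q ρ D : ℝ} (hβ : 0 < β) (hu₀ : 0 < u₀) (hA₁ : 0 < A₁) (hc : 0 < c)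
    (hm : 0 ≤ m) (hN : 0 < N) (hL : 1 ≤ L) (hN27 : N ≤ 27 * L ^ 3) (hdeg : m + 2 * n ≤ N)
    (hlow : c * L ^ 5 ≤ m + 2 * ∑ i, b i)
    (hcount : ∀ u : ℝ, 0 < u → u ≤ u₀ →
      ((Finset.univ.filter (fun i => 1 ≤ b i * Real.sinh (β * u ^ 5) ^ 2)).card : ℝ) ≤
        (β * A₁ * N) * u ^ 6)
    (hΛ₀ : Λ₀ = 1 / Real.sinh (β * u₀ ^ 5) ^ 2) (hQ : Q = 1024 * (β * A₁) / (15 * β ^ 2 * u₀ ^ 4))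
    (hρ : 0 < ρ) (hρ2 : ρ ^ 2 = c / (108 * Q))
    (hD : D = β ^ 2 * u₀ ^ 10 * Real.cosh (β * u₀ ^ 5) ^ 2)
    (hbig : 54 * (1 + Λ₀) + 54 * Q < c * L) :
    ∃ i₀, ρ ^ 5 / (1024 * D) * L ^ 5 ≤ b i₀ := by
  classical
  have hΛ₀0 : 0 ≤ Λ₀ := by rw [hΛ₀]; positivity
  have hQ0 : 0 < Q := by rw [hQ]; positivity
  have hD0 : 0 < D := by rw [hD]; positivity
  have hn0 : (0 : ℝ) ≤ n := Nat.cast_nonneg n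
  have hcL2 : 54 * (1 + Λ₀) + 54 * Q < c * L ^ 2 := by
    have := mul_le_mul_of_nonneg_left (le_self_pow₀ hL two_ne_zero) hc.le
    linarith only [hbig, this]
  -- there is at least one `bᵢ`
  have hsum_pos : 0 < ∑ i, b i := by
    have hL3 : (0 : ℝ) < L ^ 3 := by positivity
    have h27 : 0 < c * L ^ 2 - 27 := by linarith only [hcL2, hΛ₀0, hQ0]
    have h3 := mul_pos hL3 h27
    linarith only [h3, hlow, hdeg, hn0, hN27]
  obtain ⟨i₁, hi₁, -⟩ := Finset.exists_ne_zero_of_sum_ne_zero hsum_pos.ne'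
  obtain ⟨i₀, -, hi₀⟩ := Finset.exists_max_image Finset.univ b ⟨i₁, hi₁⟩
  refine ⟨i₀, ?_⟩
  -- the least dyadic level above `b i₀`
  have hex : ∃ J : ℕ, b i₀ ≤ 1 / Real.sinh (β * (u₀ / 2 ^ J) ^ 5) ^ 2 :=
    exists_le_inv_sinh_sq hβ hu₀ (b i₀)
  obtain ⟨J, hJ, hJmin⟩ : ∃ J : ℕ, b i₀ ≤ 1 / Real.sinh (β * (u₀ / 2 ^ J) ^ 5) ^ 2 ∧
      ∀ J' < J, ¬ b i₀ ≤ 1 / Real.sinh (β * (u₀ / 2 ^ J') ^ 5) ^ 2 :=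
    ⟨Nat.find hex, Nat.find_spec hex, fun J' h => Nat.find_min hex h⟩
  -- the layer cake
  have hsum : ∑ i, b i ≤ n * Λ₀ + Q * N * 16 ^ J := by
    have h1 := sum_le_of_card_filter_le b hβ hu₀ (K := β * A₁ * N) (by positivity) hcount J
      (fun i => (hi₀ i (Finset.mem_univ _)).trans hJ)
    calc _ ≤ _ := h1
      _ = n * Λ₀ + Q * N * 16 ^ J := by rw [hΛ₀, hQ]; ring
  -- the key inequality `c L² ≤ 27 (1 + Λ₀) + 54 Q 16^J`
  have h16pos : (0 : ℝ) < 16 ^ J := by positivity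
  have hkey : c * L ^ 2 ≤ 27 * (1 + Λ₀) + 54 * Q * 16 ^ J := by
    have h2n : 2 * (n : ℝ) * Λ₀ ≤ N * Λ₀ :=
      mul_le_mul_of_nonneg_right (by linarith only [hdeg, hm]) hΛ₀0
    have h1 : c * L ^ 5 ≤ N * ((1 + Λ₀) + 2 * Q * 16 ^ J) := by
      linarith only [hlow, hsum, h2n, hdeg, hn0]
    have hX : 0 ≤ (1 + Λ₀) + 2 * Q * 16 ^ J := by positivity
    have h2 : N * ((1 + Λ₀) + 2 * Q * 16 ^ J) ≤ 27 * L ^ 3 * ((1 + Λ₀) + 2 * Q * 16 ^ J) :=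
      mul_le_mul_of_nonneg_right hN27 hX
    have hL3 : (0 : ℝ) < L ^ 3 := by positivity
    have h3 : c * L ^ 2 * L ^ 3 ≤ (27 * ((1 + Λ₀) + 2 * Q * 16 ^ J)) * L ^ 3 := by
      linarith only [h1, h2]
    have := le_of_mul_le_mul_right h3 hL3
    linarith only [this]
  -- hence `J ≥ 1`
  have hJ1 : 1 ≤ J := by
    by_contra h0
    have hJ0 : J = 0 := by omega
    rw [hJ0, pow_zero, mul_one] at hkey
    linarith only [hkey, hcL2, hΛ₀0]
  -- and `16^J ≥ ρ² L²`, `4^J ≥ ρ L`, `1024^J ≥ ρ⁵ L⁵`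
  have h16 : ρ ^ 2 * L ^ 2 ≤ (16 : ℝ) ^ J := by
    rw [hρ2, div_mul_eq_mul_div, div_le_iff₀ (by positivity)]
    linarith only [hkey, hcL2, hQ0]
  have h4 : ρ * L ≤ (4 : ℝ) ^ J := by
    have h16' : (16 : ℝ) ^ J = (4 ^ J) ^ 2 := by rw [← pow_mul, mul_comm, pow_mul]; norm_num
    rw [h16', ← mul_pow] at h16
    exact le_of_pow_le_pow_left₀ two_ne_zero (by positivity) h16
  have h1024 : ρ ^ 5 * L ^ 5 ≤ (1024 : ℝ) ^ J := by
    have : (1024 : ℝ) ^ J = (4 ^ J) ^ 5 := by rw [← pow_mul, mul_comm, pow_mul]; norm_num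
    rw [this, ← mul_pow]
    exact pow_le_pow_left₀ (by positivity) h4 5
  -- minimality of `J` bounds `b i₀` from below
  obtain ⟨J', rfl⟩ : ∃ J', J = J' + 1 := ⟨J - 1, by omega⟩
  have hlt : 1 / Real.sinh (β * (u₀ / 2 ^ J') ^ 5) ^ 2 < b i₀ := not_le.1 (hJmin J' (by omega))
  have hDB := pow_lt_of_inv_sinh_sq_lt hβ hu₀ J' hlt
  rw [← hD] at hDB
  rw [div_mul_eq_mul_div, div_le_iff₀ (by positivity)]
  have h1024' : ρ ^ 5 * L ^ 5 ≤ 1024 ^ J' * 1024 := by rw [← pow_succ]; exact h1024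
  linarith only [h1024', mul_lt_mul_of_pos_right hDB (by norm_num : (0 : ℝ) < 1024)]

/-- **S5 for abstract data.** Let `β > 0` and let `V : ℕ → ℝ`, `mag : ℝ → ℝ`,
`Ecos Eexp Etilt : ℕ → ℝ → ℝ` satisfy: (P) for every `L` a Lee–Yang package `m, n, (bᵢ)` with
`bᵢ ≥ 1`, `m + 2n ≤ (2L+1)³`, `Ecos L θ = cos^m θ ∏(1 - bᵢ sin² θ)`,
`Eexp L t = cosh^m t ∏(1 + bᵢ sinh² t)`, `Etilt L t = Eexp L t · (m tanh t + ∑ 2bᵢ sinh t cosh t /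
(1 + bᵢ sinh² t))`, `m + 2∑bᵢ = V L`; (GKS) `Etilt L (βh) ≤ (2L+1)³ mag h · Eexp L (βh)` for
`h ≥ 0`; (Var) `cL⁵ ≤ V L ≤ CL⁵` for `L ≥ 1`; (UCI) `mag h ≤ A h^{1/5}` for `0 < h ≤ h₀`. Then
there are `C'` and `L₀` such that for every `L ≥ L₀` some `θ > 0` has `θ² V L ≤ C'` and
`Ecos L θ = 0`. -/
theorem isothermForcesGap_of_hypotheses {β : ℝ} (hβ : 0 < β) (V : ℕ → ℝ) (mag : ℝ → ℝ)
    (Ecos Eexp Etilt : ℕ → ℝ → ℝ)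
    (HypP : ∀ L : ℕ, ∃ (m n : ℕ) (b : Fin n → ℝ), (∀ i, 1 ≤ b i) ∧ (m + 2 * n ≤ (2 * L + 1) ^ 3) ∧
        (∀ θ : ℝ, Ecos L θ = Real.cos θ ^ m * ∏ i, (1 - b i * Real.sin θ ^ 2)) ∧
        (∀ t : ℝ, Eexp L t = Real.cosh t ^ m * ∏ i, (1 + b i * Real.sinh t ^ 2)) ∧
        (∀ t : ℝ, Etilt L t = (Real.cosh t ^ m * ∏ i, (1 + b i * Real.sinh t ^ 2)) *
            (m * Real.tanh t +
              ∑ i, 2 * b i * Real.sinh t * Real.cosh t / (1 + b i * Real.sinh t ^ 2))) ∧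
        ((m : ℝ) + 2 * ∑ i, b i = V L))
    (HypGKS : ∀ (L : ℕ) (h : ℝ), 0 ≤ h →
      Etilt L (β * h) ≤ (2 * L + 1) ^ 3 * mag h * Eexp L (β * h))
    (HypVar : ∃ c C : ℝ, 0 < c ∧ ∀ L : ℕ, 1 ≤ L → c * (L : ℝ) ^ 5 ≤ V L ∧ V L ≤ C * (L : ℝ) ^ 5)
    (HypUCI : ∃ A h₀ : ℝ, 0 < h₀ ∧ ∀ h : ℝ, 0 < h → h ≤ h₀ → mag h ≤ A * h ^ ((1:ℝ) / 5)) :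
    ∃ C : ℝ, ∃ L₀ : ℕ, ∀ L : ℕ, L₀ ≤ L → ∃ θ : ℝ, 0 < θ ∧ θ ^ 2 * V L ≤ C ∧ Ecos L θ = 0 := by
  obtain ⟨c, C₀, hc, hV⟩ := HypVar
  obtain ⟨A, h₀, hh₀, hUCI⟩ := HypUCI
  -- constants
  obtain ⟨A₁, hA₁_def⟩ : ∃ A₁ : ℝ, A₁ = max A 1 := ⟨_, rfl⟩
  have hA₁ : 0 < A₁ := by rw [hA₁_def]; exact lt_of_lt_of_le one_pos (le_max_right _ _)
  obtain ⟨u₀, hu₀_def⟩ : ∃ u₀ : ℝ, u₀ = min h₀ 1 := ⟨_, rfl⟩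
  have hu₀ : 0 < u₀ := by rw [hu₀_def]; exact lt_min hh₀ one_pos
  have hu₀1 : u₀ ≤ 1 := by rw [hu₀_def]; exact min_le_right _ _
  have hu₀h : u₀ ≤ h₀ := by rw [hu₀_def]; exact min_le_left _ _
  -- the critical isotherm in the variable `u = h^{1/5}`
  have hmag : ∀ u : ℝ, 0 < u → u ≤ u₀ → mag (u ^ 5) ≤ A₁ * u := by
    intro u hu huu
    have hu1 : u ≤ 1 := huu.trans hu₀1
    have h5 : u ^ 5 ≤ h₀ := by
      calc u ^ 5 ≤ u ^ 1 := pow_le_pow_of_le_one hu.le hu1 (by norm_num)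
        _ = u := pow_one u
        _ ≤ h₀ := huu.trans hu₀h
    have h1 := hUCI (u ^ 5) (by positivity) h5
    have hr : (u ^ 5) ^ ((1:ℝ) / 5) = u := by
      have := Real.pow_rpow_inv_natCast hu.le (n := 5) (by norm_num)
      rw [one_div]
      exact_mod_cast this
    rw [hr] at h1
    exact h1.trans (mul_le_mul_of_nonneg_right (by rw [hA₁_def]; exact le_max_left _ _) hu.le)
  obtain ⟨Λ₀, hΛ₀_def⟩ : ∃ Λ₀ : ℝ, Λ₀ = 1 / Real.sinh (β * u₀ ^ 5) ^ 2 := ⟨_, rfl⟩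
  have hΛ₀ : 0 ≤ Λ₀ := by rw [hΛ₀_def]; positivity
  obtain ⟨Q, hQ_def⟩ : ∃ Q : ℝ, Q = 1024 * (β * A₁) / (15 * β ^ 2 * u₀ ^ 4) := ⟨_, rfl⟩
  have hQ : 0 < Q := by rw [hQ_def]; positivity
  obtain ⟨ρ, hρ_def⟩ : ∃ ρ : ℝ, ρ = Real.sqrt (c / (108 * Q)) := ⟨_, rfl⟩
  have hρ : 0 < ρ := by rw [hρ_def]; exact Real.sqrt_pos.2 (by positivity)
  have hρ2 : ρ ^ 2 = c / (108 * Q) := by rw [hρ_def]; exact Real.sq_sqrt (by positivity)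
  obtain ⟨D, hD_def⟩ : ∃ D : ℝ, D = β ^ 2 * u₀ ^ 10 * Real.cosh (β * u₀ ^ 5) ^ 2 := ⟨_, rfl⟩
  have hD : 0 < D := by rw [hD_def]; positivity
  obtain ⟨c₂, hc₂_def⟩ : ∃ c₂ : ℝ, c₂ = ρ ^ 5 / (1024 * D) := ⟨_, rfl⟩
  have hc₂ : 0 < c₂ := by rw [hc₂_def]; positivity
  obtain ⟨L₀, hL₀⟩ := exists_nat_gt ((54 * (1 + Λ₀) + 54 * Q) / c + 1)
  refine ⟨Real.pi ^ 2 / 4 * C₀ / c₂, L₀, fun L hL => ?_⟩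
  -- fix `L ≥ L₀`
  have hL₀L : (L₀ : ℝ) ≤ L := by exact_mod_cast hL
  have hXc : 0 ≤ (54 * (1 + Λ₀) + 54 * Q) / c := by positivity
  have hL1R : (1 : ℝ) ≤ L := by linarith
  have hL1 : 1 ≤ L := by exact_mod_cast hL1R
  have hLpos : (0 : ℝ) < L := by linarith
  have hcL : 54 * (1 + Λ₀) + 54 * Q < c * L := by
    have : (54 * (1 + Λ₀) + 54 * Q) / c < L := by linarith
    exact (div_lt_iff₀' hc).1 this
  obtain ⟨m, n, b, hb, hdeg, hcos, hexp, htilt, hvar⟩ := HypP L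
  obtain ⟨hlow, hup⟩ := hV L hL1
  obtain ⟨N, hN_def⟩ : ∃ N : ℝ, N = (2 * (L : ℝ) + 1) ^ 3 := ⟨_, rfl⟩
  have hNpos : 0 < N := by rw [hN_def]; positivity
  have hN27 : N ≤ 27 * L ^ 3 := by
    rw [hN_def]
    have h3 : 2 * (L : ℝ) + 1 ≤ 3 * L := by linarith
    calc (2 * (L : ℝ) + 1) ^ 3 ≤ (3 * L) ^ 3 := pow_le_pow_left₀ (by positivity) h3 3
      _ = 27 * L ^ 3 := by ring
  have hdegR : (m : ℝ) + 2 * n ≤ N := by rw [hN_def]; exact_mod_cast hdeg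
  -- the tilted bound: domination at `h = u⁵`, cancel `Eexp L (βu⁵) > 0`, isotherm
  have htb : ∀ u : ℝ, 0 < u → u ≤ u₀ →
      (m : ℝ) * Real.tanh (β * u ^ 5) + ∑ i, 2 * b i * Real.sinh (β * u ^ 5) *
        Real.cosh (β * u ^ 5) / (1 + b i * Real.sinh (β * u ^ 5) ^ 2) ≤ N * (A₁ * u) := by
    intro u hu huu
    have hG := HypGKS L (u ^ 5) (by positivity)
    rw [htilt, hexp, ← hN_def] at hG
    have hE : 0 < Real.cosh (β * u ^ 5) ^ m * ∏ i, (1 + b i * Real.sinh (β * u ^ 5) ^ 2) := by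
      apply mul_pos (pow_pos (Real.cosh_pos _) _)
      apply Finset.prod_pos
      intro i _
      have := hb i
      positivity
    have hS := le_of_mul_le_mul_left (hG.trans_eq (mul_comm _ _)) hE
    exact hS.trans (mul_le_mul_of_nonneg_left (hmag u hu huu) hNpos.le)
  -- the counting bound
  have hcount : ∀ u : ℝ, 0 < u → u ≤ u₀ →
      ((Finset.univ.filter (fun i => 1 ≤ b i * Real.sinh (β * u ^ 5) ^ 2)).card : ℝ) ≤
        (β * A₁ * N) * u ^ 6 := by
    intro u hu huu
    have h1 := card_filter_le_mul_of_tilted_sum_le b hb (t := β * u ^ 5) (by positivity)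
      (Nat.cast_nonneg m) (htb u hu huu)
    calc _ ≤ β * u ^ 5 * (N * (A₁ * u)) := h1
      _ = β * A₁ * N * u ^ 6 := by ring
  have hlow' : c * (L : ℝ) ^ 5 ≤ m + 2 * ∑ i, b i := by rw [hvar]; exact hlow
  obtain ⟨i₀, hbig⟩ := exists_coeff_ge b hβ hu₀ hA₁ hc (Nat.cast_nonneg m) hNpos hL1R hN27
    hdegR hlow' hcount hΛ₀_def hQ_def hρ hρ2 hD_def hcL
  rw [← hc₂_def] at hbig
  have hB1 : 1 ≤ b i₀ := hb i₀
  -- the zero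
  obtain ⟨θ, hθ, hθB, hsin⟩ := exists_pos_sin_sq_mul_eq_one hB1
  refine ⟨θ, hθ, ?_, ?_⟩
  · have hVpos : 0 < V L := lt_of_lt_of_le (by positivity) hlow
    have hC₀L : 0 ≤ C₀ * L ^ 5 := hVpos.le.trans hup
    have hb0 : 0 < b i₀ := by linarith
    have hθ2 : θ ^ 2 ≤ Real.pi ^ 2 / 4 / b i₀ := by rw [le_div_iff₀ hb0]; exact hθB
    calc θ ^ 2 * V L ≤ θ ^ 2 * (C₀ * L ^ 5) := mul_le_mul_of_nonneg_left hup (sq_nonneg _)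
      _ ≤ Real.pi ^ 2 / 4 / b i₀ * (C₀ * L ^ 5) := mul_le_mul_of_nonneg_right hθ2 hC₀L
      _ ≤ Real.pi ^ 2 / 4 / (c₂ * L ^ 5) * (C₀ * L ^ 5) :=
          mul_le_mul_of_nonneg_right
            (div_le_div_of_nonneg_left (by positivity) (by positivity) hbig) hC₀L
      _ = Real.pi ^ 2 / 4 * C₀ / c₂ := by field_simp
  · rw [hcos]
    apply mul_eq_zero_of_right
    apply Finset.prod_eq_zero (Finset.mem_univ i₀)
    linarith

/-- **S5 — ISOTHERM FORCES GAP** (registered stub of line `SketchPub`, crux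
`CoulombImpliesNontrivial`). The Lee–Yang package of every critical block, block-field domination,
the two-sided `L⁵` block variance and the critical-isotherm bound `m(β_c,h) ≤ A h^{1/5}` force, for
all large `L`, a zero `θ₁` of `θ ↦ ⟨cos(θ M_L)⟩_{β_c}` with `θ₁² Σ_L ≤ C`: the instance of
`isothermForcesGap_of_hypotheses` at `β = β_c(3) > 0` (`criticalBeta_pos_holds`),
`V L = ⟨M_L²⟩`, `mag = m(β_c, ·)`, `Ecos L θ = ⟨cos(θM_L)⟩`, `Eexp L t = ⟨e^{tM_L}⟩`,
`Etilt L t = ⟨M_L e^{tM_L}⟩`. -/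
theorem stub_isothermForcesGap :
    (∀ L : ℕ, ∃ (m n : ℕ) (b : Fin n → ℝ), (∀ i, 1 ≤ b i) ∧ (m + 2 * n ≤ (2 * L + 1) ^ 3) ∧
        (∀ θ : ℝ, plusExpect 3 (criticalBeta 3) 0 (fun σ => Real.cos (θ * ∑ x ∈ box 3 L, spinAt x σ)) =
          Real.cos θ ^ m * ∏ i, (1 - b i * Real.sin θ ^ 2)) ∧
        (∀ t : ℝ, plusExpect 3 (criticalBeta 3) 0 (fun σ => Real.exp (t * ∑ x ∈ box 3 L, spinAt x σ)) =
          Real.cosh t ^ m * ∏ i, (1 + b i * Real.sinh t ^ 2)) ∧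
        (∀ t : ℝ, plusExpect 3 (criticalBeta 3) 0
            (fun σ => (∑ x ∈ box 3 L, spinAt x σ) * Real.exp (t * ∑ x ∈ box 3 L, spinAt x σ)) =
          (Real.cosh t ^ m * ∏ i, (1 + b i * Real.sinh t ^ 2)) *
            (m * Real.tanh t + ∑ i, 2 * b i * Real.sinh t * Real.cosh t / (1 + b i * Real.sinh t ^ 2))) ∧
        ((m : ℝ) + 2 * ∑ i, b i = plusExpect 3 (criticalBeta 3) 0 (fun σ => (∑ x ∈ box 3 L, spinAt x σ) ^ 2))) →
    (∀ (L : ℕ) (h : ℝ), 0 ≤ h →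
      plusExpect 3 (criticalBeta 3) 0
          (fun σ => (∑ x ∈ box 3 L, spinAt x σ) *
            Real.exp (criticalBeta 3 * h * ∑ x ∈ box 3 L, spinAt x σ))
        ≤ (2 * L + 1) ^ 3 * magnetizationInField 3 (criticalBeta 3) h *
          plusExpect 3 (criticalBeta 3) 0
            (fun σ => Real.exp (criticalBeta 3 * h * ∑ x ∈ box 3 L, spinAt x σ))) →
    (∃ c C : ℝ, 0 < c ∧ ∀ L : ℕ, 1 ≤ L →
        c * (L : ℝ) ^ 5 ≤ plusExpect 3 (criticalBeta 3) 0 (fun σ => (∑ x ∈ box 3 L, spinAt x σ) ^ 2) ∧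
        plusExpect 3 (criticalBeta 3) 0 (fun σ => (∑ x ∈ box 3 L, spinAt x σ) ^ 2) ≤ C * (L : ℝ) ^ 5) →
    (∃ A h₀ : ℝ, 0 < h₀ ∧ ∀ h : ℝ, 0 < h → h ≤ h₀ →
        magnetizationInField 3 (criticalBeta 3) h ≤ A * h ^ ((1:ℝ) / 5)) →
    ∃ C : ℝ, ∃ L₀ : ℕ, ∀ L : ℕ, L₀ ≤ L → ∃ θ : ℝ, 0 < θ ∧
      θ ^ 2 * plusExpect 3 (criticalBeta 3) 0 (fun σ => (∑ x ∈ box 3 L, spinAt x σ) ^ 2) ≤ C ∧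
      plusExpect 3 (criticalBeta 3) 0 (fun σ => Real.cos (θ * ∑ x ∈ box 3 L, spinAt x σ)) = 0 := by
  intro HypP HypGKS HypVar HypUCI
  exact isothermForcesGap_of_hypotheses (criticalBeta_pos_holds (d := 3) (by norm_num))
    (fun L => plusExpect 3 (criticalBeta 3) 0 (fun σ => (∑ x ∈ box 3 L, spinAt x σ) ^ 2))
    (magnetizationInField 3 (criticalBeta 3))
    (fun L θ => plusExpect 3 (criticalBeta 3) 0
      (fun σ => Real.cos (θ * ∑ x ∈ box 3 L, spinAt x σ)))
    (fun L t => plusExpect 3 (criticalBeta 3) 0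
      (fun σ => Real.exp (t * ∑ x ∈ box 3 L, spinAt x σ)))
    (fun L t => plusExpect 3 (criticalBeta 3) 0
      (fun σ => (∑ x ∈ box 3 L, spinAt x σ) * Real.exp (t * ∑ x ∈ box 3 L, spinAt x σ)))
    HypP HypGKS HypVar HypUCI

end Summit.CriticalPhenomena.Ising3DConformalLimit.PerfectScreeningCoulombImpliesNontrivial
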